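import Summits.QuantumFields.YangMills.Theorems.BalabanUVNodesPortU8TwoVolumeRowLocUniv
import Summits.QuantumFields.YangMills.Theorems.BalabanUVNodesPortU8SkeletonV13

/-!
# PORT PT-B (U8), g4 file 4 — ★★★ `response9D_LocUniv_of_tokens`: THE FULL `Response9D` PACKAGE (R0)(R1ᴰ)(R3)(R4ᴰ)(R5) FOR THE WHOLE-TORUS LOCALIZED (Landau, chart-unit)
# RESPONSE DATA `Gk n := recordGkLocWξ F θ k (K₀+n) Finset.univ a` — the SELECTOR-FREE twin of v11-G₄'s (C1) — from EXACTLY two displayed token families: (‴-LocUniv) the four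
# (190)-clauses on `recordHrLocξ … Finset.univ` and (Tok-cmpU-cap) VERBATIM.  No `recordHr` ∕ `recordBgField` ∕ `UkSel` ∕ `rootGauge`, no Tok-182, no TokP9reg ∕ analyticity premise

Cell `ym-nodeO-ideate` ∕ `ym-balaban-port`, porter `ymgap-nodeO-port-PTB-1` (gen 4).  JOIN-side helper for the decay road of **stmt-QuantumFields-27238** (K0ᴬ),
`--supports stmt-QuantumFields-27238 --as helper`, per ★★★ director-ym №509 (iii′) ∕ №512 («the U8-type supply of the K0ᴬ decay road comes from `recordHrLocξ`-objects —
never again from a displayed hypothesis on `rootGauge ∘ UkSel` objects»).  [I] = [Balaban1987RG1], [15] = [Balaban1985Variational], [B6] = [Balaban1984PropagatorsII].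

THE DATA.  `recordResponse9DataFromL F θ a Mc k K₀` with its response field REPLACED by the whole-torus localized response (structure update, no new definition):
`{ recordResponse9DataFromL F θ a Mc k K₀ with Gk := fun n => recordGkLocWξ F θ k (K₀ + n) Finset.univ a }` — index ∕ window ∕ chart ∕ wrap fields are the record's centred
two-block ones (so (R3)(R5) are ✓`rowR3_fromJ` ∕ ✓`rowR5_fromJ`).  A record NAME for this data is the names desk's (DEF-1) to give; a `rfl` bridge re-keys this file then.

WHAT IS PROVED (kernel, sorry-free).
§1 `response9D_LocUniv_of_decayRows` — the frame: (R0) from the constants' signs, (R3)(R5) by ✓p796246, (R1ᴰ)(R4ᴰ) displayed as rows.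
§2 ★★★ `response9D_LocUniv_of_tokens` — for every `α₂ > 0` there are `C₉ ≥ 0`, `δ₀ > 0` (uniform in `k, ε₂₉, a, n`) with `Response9D` of the data above in the (4.4)-gauge of
   `recordDom44J … α₂`, window `recordRNat`, GIVEN (‴-LocUniv) `∃ C₉′ δ₉, …` the four (190)-clauses with `Hr := recordHrLocξ F θ k (K₀+n) Finset.univ a (μ, y)` for all
   `k n ε₂₉ a μ y` ([15] Prop. 9 p.309 ∕ (190) p.308 for the torus Landau propagator of the whole-torus window [B6] (2.5)–(2.6), `Ω₀ = T`) and (Tok-cmpU-cap) VERBATIM as in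
   v11-G₄ (`hL.2.2`; [I] p.290 L17–20).  Rows: (R1ᴰ) ✓`rowR1D_Loc_at` (W := univ); (R4ᴰ) ✓`rowR4D_LocUniv_sandwich` (g4 file 2) with the constants unified as in
   ✓`portPieceLocalityU8_v13` (`C = max (max C_L C_c) 1`, `δ = min δ_L δ_c`, `C₉ = max A C₄`, `δ₀ = min δ_L (δ∕4)`).

HONEST FRAMING.  An implication from DISPLAYED token-shaped hypotheses (asserted by nobody) to the `Response9D` rows of selector-free data; nothing of Bałaban's analysis is
asserted ∕ ported ∕ discharged; 27931 CLOSED · IMPLICATION-ONLY (unchanged); K0ᴬ 27238 OPEN; NODE O 0∕1; COUNT 8∕28 · K 1∕4 UNMOVED; finite `𝕋⁴_{L^K}` at fixed ε — NOT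
continuum ∕ OS ∕ Clay; **the Yang–Mills mass gap (Clay) is NOT proved by any of this.**
-/

noncomputable section

open scoped BigOperators Matrix.Norms.L2Operator

namespace Summit.QuantumFields.YangMills.Theorems.PortU8

open Literature.MathematicalPhysics.QuantumFieldTheory.Balaban1983to89
open Literature.MathematicalPhysics.QuantumFieldTheory.Balaban1983to89.Node00
open Literature.MathematicalPhysics.QuantumFieldTheory.Balaban1983to89.T4Continuum (T4Family)
open Summit.QuantumFields.YangMills.Theorems.K0RecordFormatNames

variable (F : T4Family)

/-! ## §1  The frame for the whole-torus localized data -/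

variable {F} in
/-- **`Response9D` FOR THE WHOLE-TORUS LOCALIZED DATA FROM ITS TWO DECAY ROWS**: (R0) from the constants' signs, (R3)(R5) by ✓p796246 (the index ∕ window ∕ chart fields ARE
`…FromJ`'s), (R1ᴰ)(R4ᴰ) displayed. [cite: Balaban1985Variational, Prop. 9 p.309; Balaban1987RG1, (1.21) p.264, (4.35) p.290] -/
theorem response9D_LocUniv_of_decayRows {Mc : ℕ} (hMc : McGuard F Mc) (θ : Stage13Params F 2) (a : θ.ιβ) (k : ℕ) {α₂ C₉ δ₀ : ℝ}
    (hC : 0 ≤ C₉) (hδ : 0 ≤ δ₀)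
    (hR1 : ∀ (n : ℕ) (X : (recordDomSys F Mc k (recordK₀ F Mc k + n)).Dom) (y : RespLabel F k (recordK₀ F Mc k + n)),
      gauge (recordDom44J F Mc k (recordK₀ F Mc k + n) X α₂)
        (B12FormatPlus.cutTo (recordCXJ F Mc k (recordK₀ F Mc k + n) X) (recordGkLocWξ F θ k (recordK₀ F Mc k + n) Finset.univ a y)) ≤
        C₉ * Real.exp (-δ₀ * (recordSiteGeom F Mc k (recordK₀ F Mc k + n)).distD y X))
    (hR4 : ∀ (n : ℕ) (X : (recordDomSys F Mc k (recordK₀ F Mc k + n)).Dom), X ∉ recordWrapCtr F Mc k (recordK₀ F Mc k + n) →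
      ∀ (μ : Fin 4) (z : Fin 4 → ℤ), (∀ l, 2 * |z l| < (recordRNat F Mc k (recordK₀ F Mc k + n) : ℤ)) →
      gauge (recordDom44J F Mc k (recordK₀ F Mc k + n) X α₂)
        (B12FormatPlus.cutTo (recordCXJ F Mc k (recordK₀ F Mc k + n) X) fun i =>
          recordGkLocWξ F θ k (recordK₀ F Mc k + (n + 1)) Finset.univ a (recordE F k (recordK₀ F Mc k + (n + 1)) μ z) (recordJXJ F (recordK₀ F Mc k + n) i) -
            recordGkLocWξ F θ k (recordK₀ F Mc k + n) Finset.univ a (recordE F k (recordK₀ F Mc k + n) μ z) i) ≤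
        C₉ * Real.exp (-δ₀ * (recordRNat F Mc k (recordK₀ F Mc k + n) : ℝ) / 2) *
          Real.exp (-(δ₀ / 2) * (recordSiteGeom F Mc k (recordK₀ F Mc k + n)).distD (recordE F k (recordK₀ F Mc k + n) μ z) X)) :
    B12FormatPlus.Response9D ({ recordResponse9DataFromL F θ a Mc k (recordK₀ F Mc k) with Gk := fun n => recordGkLocWξ F θ k (recordK₀ F Mc k + n) Finset.univ a })
      (fun n => recordChartJ F Mc k (recordK₀ F Mc k + n))
      (fun n => recordRNat F Mc k (recordK₀ F Mc k + n)) (fun n X => recordDom44J F Mc k (recordK₀ F Mc k + n) X α₂) C₉ δ₀ :=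
  ⟨hC, hδ, hR1, fun n X hX _ hi => rowR3_fromJ hMc θ a k n X hX hi, hR4, fun n X hX w' => rowR5_fromJ hMc θ a k n X hX w'⟩

/-! ## §2  ★★★ The tokens-to-rows theorem for the whole-torus localized data -/

/-- ★★★ **`Response9D` FOR THE WHOLE-TORUS LOCALIZED RESPONSE DATA FROM (‴-LocUniv) AND (Tok-cmpU-cap) — SELECTOR-FREE.**  For every `α₂ > 0` there are `C₉ ≥ 0`, `δ₀ > 0`
such that for all `k`, `ε₂₉ > 0` and every colour `a`, the data `{ recordResponse9DataFromL … with Gk := fun n => recordGkLocWξ F θ k (K₀+n) Finset.univ a }` satisfies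
`B12FormatPlus.Response9D` in the (4.4)-gauge of `recordDom44J … α₂` with window `recordRNat`, PROVIDED (‴-LocUniv) the four (190)-clauses hold for
`Hr := recordHrLocξ F θ k (K₀+n) Finset.univ a (μ, y)` at every member and label and (Tok-cmpU-cap) the un-windowed∕windowed comparison of the same chain holds (both DISPLAYED,
the letters of v11-G₄'s `hL.1` with `recordHr ↦ recordHrLocξ … Finset.univ` and of `hL.2.2` verbatim).  Rows: (R1ᴰ) ✓`rowR1D_Loc_at`, (R3)(R5) ✓p796246, (R4ᴰ) ✓`rowR4D_LocUniv_sandwich`.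
Nothing of `recordHr`, `recordBgField`, `UkSel`, `rootGauge`, Tok-182 or TokP9reg occurs.
[cite: Balaban1985Variational, Prop. 9 p.309, (190) p.308; Balaban1987RG1, (1.21) p.264, (4.4)–(4.5) pp.281–282, p.290 L17–20, (4.35) p.290; Balaban1984PropagatorsII, (2.5)–(2.6) p.224, (2.35) p.228] -/
theorem response9D_LocUniv_of_tokens (Mc : ℕ) (a₀ : ℝ) (hMc : McGuard F Mc)
    (hL3 : ∃ C₉' δ₉ : ℝ, 0 ≤ C₉' ∧ 0 < δ₉ ∧ ∀ (k n : ℕ) (ε₂₉ : ℝ), 0 < ε₂₉ → letI θ := thetaFill F a₀ ε₂₉; letI := θ.instVβ₁; letI := θ.instVβ₂; letI := θ.instιβ;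
      ∀ (a : θ.ιβ) (μ : Fin (F.P (recordK₀ F Mc k + n)).d) (y : Site (F.P (recordK₀ F Mc k + n)) (k + 1)),
      letI Hr : PBond (F.P (recordK₀ F Mc k + n)) 0 → Fin 2 → Fin 2 → ℂ := fun b' => recordHrLocξ F θ k (recordK₀ F Mc k + n) Finset.univ a (μ, y) b';
      ∀ b : PBond (F.P (recordK₀ F Mc k + n)) 0,
        ‖Hr b‖ ≤ C₉' * (F.P (recordK₀ F Mc k + n)).eta (k + 1) * Real.exp (-(δ₉ * (Site.tdist (coarsenTo (k + 1) b.src) y : ℝ))) ∧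
        (∀ ν : Fin (F.P (recordK₀ F Mc k + n)).d, ‖Hr ⟨b.src.shift ν, b.dir⟩ - Hr b‖ ≤ C₉' * (F.P (recordK₀ F Mc k + n)).eta (k + 1) ^ 2 * Real.exp (-(δ₉ * (Site.tdist (coarsenTo (k + 1) b.src) y : ℝ)))) ∧
        ‖∑ ν : Fin (F.P (recordK₀ F Mc k + n)).d, (Hr ⟨b.src.shift ν, b.dir⟩ - (2 : ℂ) • Hr b + Hr ⟨b.src.unshift ν, b.dir⟩)‖ ≤
          C₉' * (F.P (recordK₀ F Mc k + n)).eta (k + 1) ^ 3 * Real.exp (-(δ₉ * (Site.tdist (coarsenTo (k + 1) b.src) y : ℝ))) ∧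
        ‖∑ ν : Fin (F.P (recordK₀ F Mc k + n)).d, ((Hr ⟨b.src, b.dir⟩ + Hr ⟨(b.src).shift b.dir, ν⟩ - Hr ⟨(b.src).shift ν, b.dir⟩ - Hr ⟨b.src, ν⟩) -
          (Hr ⟨b.src.unshift ν, b.dir⟩ + Hr ⟨(b.src.unshift ν).shift b.dir, ν⟩ - Hr ⟨(b.src.unshift ν).shift ν, b.dir⟩ - Hr ⟨b.src.unshift ν, ν⟩))‖ ≤
          C₉' * (F.P (recordK₀ F Mc k + n)).eta (k + 1) ^ 3 * Real.exp (-(δ₉ * (Site.tdist (coarsenTo (k + 1) b.src) y : ℝ))))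
    (hcmp : ∃ C₉' δ₉ : ℝ, 0 ≤ C₉' ∧ 0 < δ₉ ∧ ∀ (k n : ℕ) (ε₂₉ : ℝ), 0 < ε₂₉ → letI θ := thetaFill F a₀ ε₂₉; letI := θ.instVβ₁; letI := θ.instVβ₂; letI := θ.instιβ;
      ∀ (a : θ.ιβ) (μ : Fin (F.P (recordK₀ F Mc k + n)).d) (y : Site (F.P (recordK₀ F Mc k + n)) (k + 1)),
      ∀ R3 R0 : ℕ, R3 + nestRadius Mc 1 ≤ R0 → 2 * (R0 + 1) < (F.P (recordK₀ F Mc k + n)).sitesPerDir (k + 1) → ∀ z₀ : Fin 4 → ℤ, y ∈ recordWindow F k (recordK₀ F Mc k + n) R3 z₀ →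
      letI Hd : PBond (F.P (recordK₀ F Mc k + n)) 0 → Fin 2 → Fin 2 → ℂ := fun b' => recordHrLocξ F θ k (recordK₀ F Mc k + n) Finset.univ a (μ, y) b' -
        recordHrLocξ F θ k (recordK₀ F Mc k + n) (recordWindow F k (recordK₀ F Mc k + n) R0 z₀) a (μ, y) b';
      ∀ b : PBond (F.P (recordK₀ F Mc k + n)) 0, coarsenTo (k + 1) b.src ∈ recordWindow F k (recordK₀ F Mc k + n) R3 z₀ →
        ‖Hd b‖ ≤ C₉' * (F.P (recordK₀ F Mc k + n)).eta (k + 1) * Real.exp (-(δ₉ * ((R0 : ℝ) - (R3 : ℝ)))) ∧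
        (∀ ν : Fin (F.P (recordK₀ F Mc k + n)).d, ‖Hd ⟨b.src.shift ν, b.dir⟩ - Hd b‖ ≤ C₉' * (F.P (recordK₀ F Mc k + n)).eta (k + 1) ^ 2 * Real.exp (-(δ₉ * ((R0 : ℝ) - (R3 : ℝ))))) ∧
        ‖∑ ν : Fin (F.P (recordK₀ F Mc k + n)).d, (Hd ⟨b.src.shift ν, b.dir⟩ - (2 : ℂ) • Hd b + Hd ⟨b.src.unshift ν, b.dir⟩)‖ ≤
          C₉' * (F.P (recordK₀ F Mc k + n)).eta (k + 1) ^ 3 * Real.exp (-(δ₉ * ((R0 : ℝ) - (R3 : ℝ)))) ∧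
        ‖∑ ν : Fin (F.P (recordK₀ F Mc k + n)).d, ((Hd ⟨b.src, b.dir⟩ + Hd ⟨(b.src).shift b.dir, ν⟩ - Hd ⟨(b.src).shift ν, b.dir⟩ - Hd ⟨b.src, ν⟩) -
          (Hd ⟨b.src.unshift ν, b.dir⟩ + Hd ⟨(b.src.unshift ν).shift b.dir, ν⟩ - Hd ⟨(b.src.unshift ν).shift ν, b.dir⟩ - Hd ⟨b.src.unshift ν, ν⟩))‖ ≤
          C₉' * (F.P (recordK₀ F Mc k + n)).eta (k + 1) ^ 3 * Real.exp (-(δ₉ * ((R0 : ℝ) - (R3 : ℝ)))))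
    (α₂ : ℝ) (hα₂ : 0 < α₂) :
    ∃ C₉ δ₀ : ℝ, 0 ≤ C₉ ∧ 0 < δ₀ ∧ ∀ k : ℕ, ∀ ε₂₉ : ℝ, 0 < ε₂₉ → ∀ a : (thetaFill F a₀ ε₂₉).ιβ,
      B12FormatPlus.Response9D
        ({ recordResponse9DataFromL F (thetaFill F a₀ ε₂₉) a Mc k (recordK₀ F Mc k) with
            Gk := fun n => recordGkLocWξ F (thetaFill F a₀ ε₂₉) k (recordK₀ F Mc k + n) Finset.univ a })
        (fun n => recordChartJ F Mc k (recordK₀ F Mc k + n)) (fun n => recordRNat F Mc k (recordK₀ F Mc k + n))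
        (fun n X => recordDom44J F Mc k (recordK₀ F Mc k + n) X α₂) C₉ δ₀ := by
  obtain ⟨CL, δL, hCL0, hδL, hLall⟩ := hL3
  obtain ⟨Cc, δc, hCc0, hδc, hcmpAll⟩ := hcmp
  -- unified token constants
  obtain ⟨C, hCdef⟩ : ∃ C : ℝ, C = max (max CL Cc) 1 := ⟨_, rfl⟩
  obtain ⟨δ, hδdef⟩ : ∃ δ : ℝ, δ = min δL δc := ⟨_, rfl⟩
  have hC0 : 0 < C := hCdef ▸ lt_of_lt_of_le one_pos (le_max_right _ _)
  have hCL : CL ≤ C := hCdef ▸ (le_max_left _ _).trans (le_max_left _ _)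
  have hCc : Cc ≤ C := hCdef ▸ (le_max_right _ _).trans (le_max_left _ _)
  have hδ0 : 0 < δ := hδdef ▸ lt_min hδL hδc
  have hδL' : δ ≤ δL := hδdef ▸ min_le_left _ _
  have hδc' : δ ≤ δc := hδdef ▸ min_le_right _ _
  have eL : ∀ t : ℝ, 0 ≤ t → Real.exp (-(δL * t)) ≤ Real.exp (-(δ * t)) := fun t ht => Real.exp_le_exp.2 (neg_le_neg (mul_le_mul_of_nonneg_right hδL' ht))
  have ec : ∀ R3 R0 : ℕ, R3 ≤ R0 → Real.exp (-(δc * ((R0 : ℝ) - (R3 : ℝ)))) ≤ Real.exp (-(δ * ((R0 : ℝ) - (R3 : ℝ)))) := fun R3 R0 h =>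
    Real.exp_le_exp.2 (neg_le_neg (mul_le_mul_of_nonneg_right hδc' (sub_nonneg.2 (Nat.cast_le.2 h))))
  -- the (R4ᴰ) row constants
  obtain ⟨C₄, hC4def⟩ : ∃ C₄ : ℝ, C₄ = 2 * C * Real.exp (δ * (2 * Mc + 2)) *
    (2 * (2 * 1 + 2 * ‖LinearMap.toContinuousLinearMap (sl2Proj.restrictScalars ℝ)‖ + 1) * Real.exp (4 * (δ / 8) * Mc) / α₂) := ⟨_, rfl⟩
  have hC4 : 0 ≤ C₄ := by rw [hC4def]; positivity
  obtain ⟨δ₄, hδ4def⟩ : ∃ δ₄ : ℝ, δ₄ = δ / 4 := ⟨_, rfl⟩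
  have hδ4 : 0 < δ₄ := by rw [hδ4def]; positivity
  -- ★ the global two-volume row (R4ᴰ) for the whole-torus localized data, PROVED (g4 file 2)
  have hR4B : ∀ k : ℕ, ∀ ε₂₉ : ℝ, 0 < ε₂₉ → ∀ a : (thetaFill F a₀ ε₂₉).ιβ, ∀ (n : ℕ) (X : (recordDomSys F Mc k (recordK₀ F Mc k + n)).Dom),
      X ∉ recordWrapCtr F Mc k (recordK₀ F Mc k + n) → ∀ (μ : Fin 4) (z : Fin 4 → ℤ), (∀ l, 2 * |z l| < (recordRNat F Mc k (recordK₀ F Mc k + n) : ℤ)) →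
      gauge (recordDom44J F Mc k (recordK₀ F Mc k + n) X α₂) (B12FormatPlus.cutTo (recordCXJ F Mc k (recordK₀ F Mc k + n) X) fun i =>
        recordGkLocWξ F (thetaFill F a₀ ε₂₉) k (recordK₀ F Mc k + (n + 1)) Finset.univ a (recordE F k (recordK₀ F Mc k + (n + 1)) μ z) (recordJXJ F (recordK₀ F Mc k + n) i) -
          recordGkLocWξ F (thetaFill F a₀ ε₂₉) k (recordK₀ F Mc k + n) Finset.univ a (recordE F k (recordK₀ F Mc k + n) μ z) i) ≤
        C₄ * Real.exp (-δ₄ * (recordRNat F Mc k (recordK₀ F Mc k + n) : ℝ) / 2) * Real.exp (-(δ₄ / 2) * (recordSiteGeom F Mc k (recordK₀ F Mc k + n)).distD (recordE F k (recordK₀ F Mc k + n) μ z) X) := by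
    intro k ε₂₉ hε a n X hX μ z hz
    rw [hC4def, hδ4def]
    exact rowR4D_LocUniv_sandwich (F := F) a₀ ε₂₉ hMc (Nat.le_add_right _ n) a μ z hz hX hC0 hδ0
      (fun b => fourClauses_weaken F _ b hCL hC0.le (eL _ (Nat.cast_nonneg _)) (Real.exp_pos _).le
        (hLall k n ε₂₉ hε a (recordE F k (recordK₀ F Mc k + n) μ z).1 (recordE F k (recordK₀ F Mc k + n) μ z).2 b))
      (fun b => fourClauses_weaken F _ b hCL hC0.le (eL _ (Nat.cast_nonneg _)) (Real.exp_pos _).le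
        (hLall k (n + 1) ε₂₉ hε a (recordE F k (recordK₀ F Mc k + n + 1) μ z).1 (recordE F k (recordK₀ F Mc k + n + 1) μ z).2 b))
      (fun R3 R0 h1 h2 z₀ hy b hb => by
        -- (the clause field `Hd` is given explicitly: higher-order inference of it is prohibitively slow here)
        have t1 := hcmpAll k n ε₂₉ hε a (recordE F k (recordK₀ F Mc k + n) μ z).1 (recordE F k (recordK₀ F Mc k + n) μ z).2 R3 R0 h1 h2 z₀ hy b hb
        exact fourClauses_weaken F
          (fun b' : PBond (F.P (recordK₀ F Mc k + n)) 0 => recordHrLocξ F (thetaFill F a₀ ε₂₉) k (recordK₀ F Mc k + n) Finset.univ a (recordE F k (recordK₀ F Mc k + n) μ z) b' -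
            recordHrLocξ F (thetaFill F a₀ ε₂₉) k (recordK₀ F Mc k + n) (recordWindow F k (recordK₀ F Mc k + n) R0 z₀) a (recordE F k (recordK₀ F Mc k + n) μ z) b')
          b hCc hC0.le (ec R3 R0 (le_trans (Nat.le_add_right _ _) h1)) (Real.exp_pos _).le t1)
      (fun R3 R0 h1 h2 z₀ hy b hb => by
        have t1 := hcmpAll k (n + 1) ε₂₉ hε a (recordE F k (recordK₀ F Mc k + n + 1) μ z).1 (recordE F k (recordK₀ F Mc k + n + 1) μ z).2 R3 R0 h1 h2 z₀ hy b hb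
        exact fourClauses_weaken F
          (fun b' : PBond (F.P (recordK₀ F Mc k + n + 1)) 0 => recordHrLocξ F (thetaFill F a₀ ε₂₉) k (recordK₀ F Mc k + n + 1) Finset.univ a (recordE F k (recordK₀ F Mc k + n + 1) μ z) b' -
            recordHrLocξ F (thetaFill F a₀ ε₂₉) k (recordK₀ F Mc k + n + 1) (recordWindow F k (recordK₀ F Mc k + n + 1) R0 z₀) a (recordE F k (recordK₀ F Mc k + n + 1) μ z) b')
          b hCc hC0.le (ec R3 R0 (le_trans (Nat.le_add_right _ _) h1)) (Real.exp_pos _).le t1)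
      hα₂
  set A : ℝ := 2 * (2 * CL + 2 * ‖LinearMap.toContinuousLinearMap (sl2Proj.restrictScalars ℝ)‖ * CL + 1) * Real.exp (4 * δL * Mc) / α₂ with hA
  have hA0 : 0 ≤ A := by rw [hA]; positivity
  refine ⟨max A C₄, min δL δ₄, le_max_of_le_left hA0, lt_min hδL hδ4, fun k ε₂₉ hε a => ?_⟩
  refine response9D_LocUniv_of_decayRows hMc (thetaFill F a₀ ε₂₉) a k (le_max_of_le_left hA0) (lt_min hδL hδ4).le ?_ ?_
  · intro n X y
    obtain ⟨μ0, y0⟩ := y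
    have hrow := rowR1D_Loc_at (F := F) hMc (Nat.le_add_right _ _) a₀ ε₂₉ Finset.univ a (μ0, y0) X hα₂ hCL0 hδL.le
      (fun b _ => hLall k n ε₂₉ hε a μ0 y0 b)
    refine hrow.trans ?_
    have hd0 : 0 ≤ (recordSiteGeom F Mc k (recordK₀ F Mc k + n)).distD (μ0, y0) X := (recordSiteGeom F Mc k (recordK₀ F Mc k + n)).distD_nonneg (μ0, y0) X
    have hexp : Real.exp (-δL * (recordSiteGeom F Mc k (recordK₀ F Mc k + n)).distD (μ0, y0) X) ≤ Real.exp (-(min δL δ₄) * (recordSiteGeom F Mc k (recordK₀ F Mc k + n)).distD (μ0, y0) X) :=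
      Real.exp_le_exp.2 (by nlinarith [min_le_left δL δ₄])
    calc A * Real.exp (-δL * (recordSiteGeom F Mc k (recordK₀ F Mc k + n)).distD (μ0, y0) X)
        ≤ max A C₄ * Real.exp (-δL * (recordSiteGeom F Mc k (recordK₀ F Mc k + n)).distD (μ0, y0) X) := mul_le_mul_of_nonneg_right (le_max_left _ _) (Real.exp_pos _).le
      _ ≤ max A C₄ * Real.exp (-(min δL δ₄) * (recordSiteGeom F Mc k (recordK₀ F Mc k + n)).distD (μ0, y0) X) := mul_le_mul_of_nonneg_left hexp (hA0.trans (le_max_left _ _))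
  · intro n X hX μ z hz
    have h4 := hR4B k ε₂₉ hε a n X hX μ z hz
    refine h4.trans ?_
    have hR0 : 0 ≤ (recordRNat F Mc k (recordK₀ F Mc k + n) : ℝ) := Nat.cast_nonneg _
    have hd0 : 0 ≤ (recordSiteGeom F Mc k (recordK₀ F Mc k + n)).distD (recordE F k (recordK₀ F Mc k + n) μ z) X := (recordSiteGeom F Mc k (recordK₀ F Mc k + n)).distD_nonneg _ X
    have hm4 : min δL δ₄ ≤ δ₄ := min_le_right _ _
    have he1 : Real.exp (-δ₄ * (recordRNat F Mc k (recordK₀ F Mc k + n) : ℝ) / 2) ≤ Real.exp (-(min δL δ₄) * (recordRNat F Mc k (recordK₀ F Mc k + n) : ℝ) / 2) :=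
      Real.exp_le_exp.2 (by nlinarith)
    have he2 : Real.exp (-(δ₄ / 2) * (recordSiteGeom F Mc k (recordK₀ F Mc k + n)).distD (recordE F k (recordK₀ F Mc k + n) μ z) X) ≤
        Real.exp (-(min δL δ₄ / 2) * (recordSiteGeom F Mc k (recordK₀ F Mc k + n)).distD (recordE F k (recordK₀ F Mc k + n) μ z) X) :=
      Real.exp_le_exp.2 (by nlinarith)
    exact mul_le_mul (mul_le_mul (le_max_right A C₄) he1 (Real.exp_pos _).le (hC4.trans (le_max_right A C₄))) he2 (Real.exp_pos _).le
      (mul_nonneg (hC4.trans (le_max_right A C₄)) (Real.exp_pos _).le)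

end Summit.QuantumFields.YangMills.Theorems.PortU8

end
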